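import Summits.QuantumFields.YangMills.Theorems.TwistedTraceScaling.Negative.QuasimodeProfileRigidity
import HarnessLib

/-!
# R68 — THE TWO-SIDED MODEL ATOM (Q±) PINS THE PROFILE EXPONENT EXACTLY: in the one-mode Mehler model, (Q+) ∧ (Q−) on a fixed inner ball for
# every `σ > 0` holds IFF the Gaussian profile is the exact ground state `c = c_* = √(a² + 2ab)`
# (crux `LuscherReduction.TwistedTraceScaling`, stmt-QuantumFields-20203; bears on w1's ✓`…BOStiffQuasimodeFrame.spec_S3_of_model` (W1-10a: spec (A) =
# `spec_S3` ⇐ MODEL ATOM (Q+) `MΘ ≤ (1+σ)λΘw` on `S`, (Q−) `(1−σ)λΘw ≤ MΘ` on the inner set `I`, (ring)), on ✓`…BOStiffRing` and on the lead's (B4b)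
# ✓`…BOStiffCentralUpper.cM_upper` / ✓`…BOStiffCentralLower.cM_lower`; sequel of ✓R67 `…Negative.QuasimodeProfileRigidity`)

Standing-disprover cycle 55, second lemma.  HONEST FRAMING: a tightness lemma about the OPEN model atom of a stub of a child of the CONDITIONAL route
R2b1 — not a gap in anything landed, not Clay.  w1's frame reduces (A) to: for every `σ > 0`, eventually in `β`, SOME level `λ(β)` satisfies the
two-sided pointwise quasimode bounds (Q+) on `cS` and (Q−) on an inner set `I` carrying all but `σ` of the `cΘ²cW`-mass (✓`eventually_ring_mass_le`:
`I ⊇` the inner twelfth of the profile ball, radius `r/12 = β^{-1/2}ℓ/12`, `ℓ = btLog β`).  The level `λ` is free, so (Q±) is a statement about the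
OSCILLATION of the ratio `ρ = MΘ/(Θw)`: `sup_S ρ / inf_I ρ ≤ (1+σ)/(1−σ)` (★ `ratio_pinch`, pure algebra).
One-mode Mehler caricature (✓R67: kernel `e^{−ax²}e^{−b(x−y)²}e^{−ay²}`, profile `f_c = e^{−cy²}`, ratio `ρ(x) = √(π/(a+b+c))·e^{κx²}`,
EXPONENT GAP `κ = (c² − a² − 2ab)/(a+b+c)`), with (Q+) and (Q−) both asked on the inner ball `[−R, R]` only (weaker than the atom):
* ★★ `twoSided_pinch` — (Q+) ∧ (Q−) on `[−R,R]` with `0 ≤ σ < 1` force `|κ|·R² ≤ log((1+σ)/(1−σ))` (`≈ 2σ`);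
* ★★★ `exponent_exact_of_twoSided` — if for EVERY `σ ∈ (0,1)` some level `λ_σ` achieves (Q±) on a fixed `[−R,R]`, `R > 0`, then `c² = a² + 2ab`:
  the atom characterises the ground-state exponent uniquely within Gaussians; ★ `twoSided_of_exact` — conversely `c² = a² + 2ab` gives (Q±) with
  `σ = 0`, `λ = √(π/(a+b+c))` (✓R67 `mehler_gaussian_exact`).  So in the model:  (Q±) ∀σ  ⟺  `c = c_*`.
READING (quantitative, for w1's (W1-10) and the lead's (B4b)→(A) step).  Lattice datum per stiff normal mode: `a = (β/2)h`, `b = β`,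
`c_* = β√(h²/4+h)`; inner radius `R = r/12 = β^{-1/2}ℓ/12`.  A relative exponent error `θ` (`c = (1+θ)c_*`) has `|κ| ≍ θβ`, so `twoSided_pinch`
demands `θ·ℓ²/144 ≲ 2σ`, i.e. RELATIVE precision `O(σ/ℓ²)` of the exponent — equivalently ABSOLUTE precision `O(σ)` of `q(x) = c‖x‖²` at the inner
edge (`q ≍ ℓ²/144` there): the passage from `e^{−(β/2)(S(oT1x)+S(oT1x'))}` (✓`cM_upper`/✓`cM_lower`, `S` = Wilson action) to the harmonic
`e^{−⟨x̂,(β/2)Hx̂⟩}` must be made with `β·|S(oT1x) − ⟨x̂,Hx̂⟩| = o(1)` UNIFORMLY on the inner ball (available: `2000|P|β·(r/12)³ = O(β^{-1/2}ℓ³) → 0`,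
✓`abs_wilsonAction_gnomonic_sub_curl_le`), and the `(1±ε)` amplitudes of the twins are harmless (they enter `σ`, not `κ`).  The tail term of ✓`cM_upper`,
`e^{2β|E|}e^{−ℓ⁴/(144L²)}`, must sit below `σ·λΘw` on the inner ball, where `λΘw ≳ e^{2β|E|}·fpWeightBar(β^{-1/2})·e^{−20ℓ²}`: an L-PRICE
`ℓ² ≫ 2880L² + 72L²·dim Γ·(log β)/ℓ²`, i.e. `β ≥ β₀(L) = e^{Θ(L)}` — admissible at fixed `L` (∀ᶠβ), recorded here so nobody reads it as L-uniform.
VERDICT 55 (unchanged): no kill; the lead's profile `stiffGaussExp L (β/2) β` IS `c_*` mode by mode, so the atom is consistent; R67/R68 state what it costs.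
[folklore] (harmonic transfer matrix / Mehler kernel: [cite: Wipf2021, §8.5.1 (8.56)–(8.58)] [cite: Wipf2021, §8.5.2 (8.64)–(8.67)]).
-/

set_option autoImplicit false

noncomputable section

open Real MeasureTheory Set

namespace Summit.QuantumFields.YangMills.Theorems.TwistedTraceScaling.Negative.R68

open Summit.QuantumFields.YangMills.Theorems.TwistedTraceScaling.Negative.R67

/-! ## §1 The pinch: (Q+) at one point and (Q−) at another bound the oscillation of the ratio `MΘ/(Θw)` -/

/-- ★ **Ratio pinch** (the content of (Q±) once the level `λ` is free): (Q+) `P ≤ (1+σ)λu` at a point with profile value `u > 0` and (Q−)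
`(1−σ)λv ≤ Q` at a point with profile value `v > 0` give `(1−σ)·(P/u) ≤ (1+σ)·(Q/v)` (`−1 ≤ σ ≤ 1`; no sign of `λ` needed). [folklore] -/
theorem ratio_pinch {P Q u v lam σ : ℝ} (hσ0 : -1 ≤ σ) (hσ1 : σ ≤ 1) (hu : 0 < u) (hv : 0 < v)
    (hplus : P ≤ (1 + σ) * lam * u) (hminus : (1 - σ) * lam * v ≤ Q) : (1 - σ) * (P / u) ≤ (1 + σ) * (Q / v) := by
  have h1 : P / u ≤ (1 + σ) * lam := by rw [div_le_iff₀ hu]; exact hplus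
  have h2 : (1 - σ) * lam ≤ Q / v := by rw [le_div_iff₀ hv]; exact hminus
  have h3 : (1 - σ) * (P / u) ≤ (1 - σ) * ((1 + σ) * lam) := mul_le_mul_of_nonneg_left h1 (by linarith)
  have h4 : (1 + σ) * ((1 - σ) * lam) ≤ (1 + σ) * (Q / v) := mul_le_mul_of_nonneg_left h2 (by linarith)
  calc (1 - σ) * (P / u) ≤ (1 - σ) * ((1 + σ) * lam) := h3
    _ = (1 + σ) * ((1 - σ) * lam) := by ring
    _ ≤ (1 + σ) * (Q / v) := h4

/-! ## §2 The one-mode Mehler model: (Q±) on a fixed inner ball measures the exponent gap -/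

/-- ★★ **Two-sided pinch in the Mehler model.**  If the Gaussian profile `f_c = e^{−c·y²}` satisfies, for some level `λ` and rate `0 ≤ σ < 1`,
(Q+) `(Kf_c)(x) ≤ (1+σ)λf_c(x)` and (Q−) `(1−σ)λf_c(x) ≤ (Kf_c)(x)` on the inner ball `|x| ≤ R`, then the exponent gap
`κ = (c² − a² − 2ab)/(a+b+c)` obeys `|κ|·R² ≤ log((1+σ)/(1−σ))`. [folklore] -/
theorem twoSided_pinch {a b c lam σ R : ℝ} (hα : 0 < a + b + c) (hσ0 : 0 ≤ σ) (hσ1 : σ < 1) (hR : 0 ≤ R)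
    (hplus : ∀ x : ℝ, |x| ≤ R →
      ∫ y, Real.exp (-(a * x ^ 2)) * Real.exp (-(b * (x - y) ^ 2)) * Real.exp (-(a * y ^ 2)) * Real.exp (-(c * y ^ 2)) ≤
        (1 + σ) * lam * Real.exp (-(c * x ^ 2)))
    (hminus : ∀ x : ℝ, |x| ≤ R → (1 - σ) * lam * Real.exp (-(c * x ^ 2)) ≤
      ∫ y, Real.exp (-(a * x ^ 2)) * Real.exp (-(b * (x - y) ^ 2)) * Real.exp (-(a * y ^ 2)) * Real.exp (-(c * y ^ 2))) :
    |(c ^ 2 - a ^ 2 - 2 * a * b) / (a + b + c)| * R ^ 2 ≤ Real.log ((1 + σ) / (1 - σ)) := by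
  set C := Real.sqrt (π / (a + b + c)) with hC
  have hC0 : 0 < C := Real.sqrt_pos.2 (div_pos Real.pi_pos hα)
  set κ := (c ^ 2 - a ^ 2 - 2 * a * b) / (a + b + c) with hκ
  have h1σ : 0 < 1 - σ := by linarith
  have hquot : 1 ≤ (1 + σ) / (1 - σ) := by rw [le_div_iff₀ h1σ]; linarith
  -- the two bounds at the points 0 and R, in ratio form
  have hR0 : |(0:ℝ)| ≤ R := by simpa using hR
  have hRR : |R| ≤ R := (abs_of_nonneg hR).le
  have hP0 := hplus 0 hR0
  have hM0 := hminus 0 hR0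
  have hPR := hplus R hRR
  have hMR := hminus R hRR
  rw [mehler_gaussian_action_ratio hα] at hP0 hM0 hPR hMR
  simp only [ne_eq, OfNat.ofNat_ne_zero, not_false_eq_true, zero_pow, mul_zero, neg_zero, Real.exp_zero, mul_one] at hP0 hM0
  have hfR : 0 < Real.exp (-(c * R ^ 2)) := Real.exp_pos _
  rcases le_or_gt 0 κ with hk | hk
  · -- κ ≥ 0: (Q−) at the centre, (Q+) at the edge
    have hpin := ratio_pinch (P := C * Real.exp (κ * R ^ 2) * Real.exp (-(c * R ^ 2))) (Q := C) (u := Real.exp (-(c * R ^ 2))) (v := 1)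
      (by linarith) hσ1.le hfR one_pos hPR (by simpa using hM0)
    rw [mul_div_assoc, div_self hfR.ne', mul_one, div_one] at hpin
    -- (1−σ)·C·e^{κR²} ≤ (1+σ)·C ⇒ e^{κR²} ≤ (1+σ)/(1−σ)
    have hexp : Real.exp (κ * R ^ 2) ≤ (1 + σ) / (1 - σ) := by
      rw [le_div_iff₀ h1σ]
      nlinarith [hpin, hC0, Real.exp_pos (κ * R ^ 2)]
    rw [abs_of_nonneg hk]
    calc κ * R ^ 2 = Real.log (Real.exp (κ * R ^ 2)) := (Real.log_exp _).symm
      _ ≤ Real.log ((1 + σ) / (1 - σ)) := Real.log_le_log (Real.exp_pos _) hexp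
  · -- κ < 0: (Q+) at the centre, (Q−) at the edge
    have hpin := ratio_pinch (P := C) (Q := C * Real.exp (κ * R ^ 2) * Real.exp (-(c * R ^ 2))) (u := 1) (v := Real.exp (-(c * R ^ 2)))
      (by linarith) hσ1.le one_pos hfR (by simpa using hP0) hMR
    rw [div_one, mul_div_assoc, div_self hfR.ne', mul_one] at hpin
    -- (1−σ)·C ≤ (1+σ)·C·e^{κR²} ⇒ e^{−κR²} ≤ (1+σ)/(1−σ)
    have hexp : Real.exp (-(κ * R ^ 2)) ≤ (1 + σ) / (1 - σ) := by
      rw [le_div_iff₀ h1σ]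
      have hmul : (1 - σ) * C * Real.exp (-(κ * R ^ 2)) ≤ (1 + σ) * (C * Real.exp (κ * R ^ 2)) * Real.exp (-(κ * R ^ 2)) :=
        mul_le_mul_of_nonneg_right (by linarith) (Real.exp_pos _).le
      have hee : Real.exp (κ * R ^ 2) * Real.exp (-(κ * R ^ 2)) = 1 := by rw [← Real.exp_add, add_neg_cancel, Real.exp_zero]
      have : (1 + σ) * (C * Real.exp (κ * R ^ 2)) * Real.exp (-(κ * R ^ 2)) = (1 + σ) * C := by
        rw [mul_assoc, mul_assoc, hee, mul_one]
      rw [this] at hmul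
      nlinarith [hmul, hC0, Real.exp_pos (-(κ * R ^ 2))]
    rw [abs_of_neg hk]
    calc -κ * R ^ 2 = Real.log (Real.exp (-(κ * R ^ 2))) := by rw [Real.log_exp]; ring
      _ ≤ Real.log ((1 + σ) / (1 - σ)) := Real.log_le_log (Real.exp_pos _) hexp

/-- ★★★ **The atom characterises the exponent.**  If for EVERY `σ ∈ (0,1)` some level `λ_σ` achieves (Q+) ∧ (Q−) for `f_c` on a fixed inner ball
`[−R, R]`, `R > 0`, then `c² = a² + 2ab` — the profile is the exact ground state (`c = c_*` for `c ≥ 0`). [folklore] -/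
theorem exponent_exact_of_twoSided {a b c R : ℝ} (hα : 0 < a + b + c) (hR : 0 < R)
    (h : ∀ σ : ℝ, 0 < σ → σ < 1 → ∃ lam : ℝ,
      (∀ x : ℝ, |x| ≤ R →
        ∫ y, Real.exp (-(a * x ^ 2)) * Real.exp (-(b * (x - y) ^ 2)) * Real.exp (-(a * y ^ 2)) * Real.exp (-(c * y ^ 2)) ≤
          (1 + σ) * lam * Real.exp (-(c * x ^ 2))) ∧
      (∀ x : ℝ, |x| ≤ R → (1 - σ) * lam * Real.exp (-(c * x ^ 2)) ≤
        ∫ y, Real.exp (-(a * x ^ 2)) * Real.exp (-(b * (x - y) ^ 2)) * Real.exp (-(a * y ^ 2)) * Real.exp (-(c * y ^ 2)))) :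
    c ^ 2 = a ^ 2 + 2 * a * b := by
  set κ := (c ^ 2 - a ^ 2 - 2 * a * b) / (a + b + c) with hκ
  -- |κ|R² ≤ 4σ for every σ ∈ (0, 1/2]
  have hbound : ∀ σ : ℝ, 0 < σ → σ ≤ 1 / 2 → |κ| * R ^ 2 ≤ 4 * σ := by
    intro σ hσ0 hσ2
    obtain ⟨lam, hplus, hminus⟩ := h σ hσ0 (by linarith)
    have hp := twoSided_pinch hα hσ0.le (by linarith) hR.le hplus hminus
    have h1σ : 0 < 1 - σ := by linarith
    have hq0 : 0 < (1 + σ) / (1 - σ) := div_pos (by linarith) h1σ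
    have hlog : Real.log ((1 + σ) / (1 - σ)) ≤ (1 + σ) / (1 - σ) - 1 := Real.log_le_sub_one_of_pos hq0
    have hq : (1 + σ) / (1 - σ) - 1 ≤ 4 * σ := by
      rw [div_sub_one h1σ.ne', div_le_iff₀ h1σ]; nlinarith
    linarith
  have hk0 : |κ| * R ^ 2 ≤ 0 := by
    by_contra hne
    rw [not_le] at hne
    have hσ := hbound (min (1 / 2) (|κ| * R ^ 2 / 8)) (lt_min (by norm_num) (by positivity)) (min_le_left _ _)
    have := min_le_right (1 / 2 : ℝ) (|κ| * R ^ 2 / 8)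
    linarith
  have hR2 : 0 < R ^ 2 := by positivity
  have habs : |κ| = 0 := le_antisymm (by nlinarith [abs_nonneg κ]) (abs_nonneg κ)
  have hκ0 : κ = 0 := abs_eq_zero.1 habs
  rw [hκ, div_eq_zero_iff] at hκ0
  rcases hκ0 with h0 | h0
  · linarith
  · exact absurd h0 hα.ne'

/-- ★ Converse: the exact ground state `c² = a² + 2ab` satisfies (Q+) ∧ (Q−) with `σ = 0` and the level `λ = √(π/(a+b+c))`, everywhere. [folklore] -/
theorem twoSided_of_exact {a b c : ℝ} (hα : 0 < a + b + c) (hc : c ^ 2 = a ^ 2 + 2 * a * b) (x : ℝ) :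
    ∫ y, Real.exp (-(a * x ^ 2)) * Real.exp (-(b * (x - y) ^ 2)) * Real.exp (-(a * y ^ 2)) * Real.exp (-(c * y ^ 2)) ≤
        (1 + 0) * Real.sqrt (π / (a + b + c)) * Real.exp (-(c * x ^ 2)) ∧
      (1 - 0) * Real.sqrt (π / (a + b + c)) * Real.exp (-(c * x ^ 2)) ≤
        ∫ y, Real.exp (-(a * x ^ 2)) * Real.exp (-(b * (x - y) ^ 2)) * Real.exp (-(a * y ^ 2)) * Real.exp (-(c * y ^ 2)) := by
  rw [mehler_gaussian_exact hα hc x]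
  constructor <;> simp

end Summit.QuantumFields.YangMills.Theorems.TwistedTraceScaling.Negative.R68

end
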